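import Summits.ResolutionOfSingularities.ResolutionOfSingularities.Theorems.NearExitFace
import Summits.ResolutionOfSingularities.ResolutionOfSingularities.Theorems.NearExitFibre

/-!
# NearExit (S5′) — the geometric point of a generic fibre prime and the contradiction with genericity

Node «NearExit» of `decomp-res-lens-2` (g33).  `κ` a field (the residue field), `Ω ⊇ κ` algebraically closed,
`F = κ[X_k : k ≠ j]` the coordinate ring of the chart `{X_j ≠ 0}` of the fibre `ℙ^d_κ = Proj κ[X₀, …, X_d]` of the
first blow-up, `𝔮 ⊂ F` a prime with `X₀ ∈ 𝔮` (a NEAR point lies on the hyperplane `X₀ = 0` of the directrix) —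
the point `x'` need NOT be closed.  The face form read in the chart is `Φ̄ = Ḡ(fibreCoord) = Ḡ(0, X₁, …, 1_j, …, X_d)`.

MAIN RESULT `false_of_generic`: if `s · Φ̄ ∈ 𝔮ⁿ` for some `s ∉ 𝔮` («`Φ̄` has order `≥ n` at `x'`»), if none of the
RATIONAL points `ω_i = (w̄_{ik}/w̄_{ij})_k` of the list lies in the closure of `x'` (hypothesis `hM`, the fibre
reading of «`x'` is not on the strict transform of the curve germ `(c_k - ŵ_{ik} c_j)_k`»), and if the genericity
clause of `VeryNearCutClasses.HasNearGenericFace` holds (every non-listed tangent direction `v` with `v₀ = 0` has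
`MultLT (geomFace) v n`), then `False`.  Mechanism:
* Jacobson avoidance (`NearExit.exists_isMaximal_avoid`): a CLOSED point `𝔪̄ ⊇ 𝔮` of the fibre chart off the listed
  rational points and off `V(s)`, so `Φ̄ ∈ 𝔪̄ⁿ`;
* the geometric point `ρ : F → F/𝔪̄ ↪ Ω` (Zariski/Nullstellensatz: `F/𝔪̄` is algebraic over `κ`;
  `IsAlgClosed.lift`), `v_k = ρ(X_k)`, `v_j = 1`, `v₀ = ρ(X₀) = 0`;
* the embedding `fibreEmb : F → Ω[X₀, …, X_d]` followed by the Taylor translation `T_v` sends `𝔪̄` into the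
  irrelevant ideal `𝔙 = (X₀, …, X_d)` (constant coefficient `= ρ`), hence `T_v(δ_j geomFace) ∈ 𝔙ⁿ`, and the face
  transfer `NearExit.not_multLT_of_mem_pow` gives `¬ MultLT (geomFace) v n`;
* so `v` matches a listed direction `w̄_i`; then `w̄_{ij} ≠ 0`, `ρ` factors through evaluation at `ω_i`, and
  `𝔪̄ = ker (ev_{ω_i})` IS a listed rational point — contradiction.

Sources: [CossartPiltant2008] proof of Prop. 4.2 (near points of the first blow-up lie on the projectivised
directrix; the argument at non-closed points via closed specialisations); [Hironaka1964] Ch. III §3;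
Mathlib `MvPolynomial.comp_C_integral_of_surjective_of_isJacobsonRing` (Zariski's lemma), `IsAlgClosed.lift`.
-/

open MvPolynomial

namespace Summit.ResolutionOfSingularities.ResolutionOfSingularities.Theorems.NearExit

section FibreCoord

variable {κ : Type} [CommRing κ] {Ω : Type} [CommRing Ω] [Algebra κ Ω] {d : ℕ} (j : Fin (d + 1))

variable (κ) in
/-- The coordinates of the fibre chart `{X_j ≠ 0} ∩ {X₀ = 0}`: `X₀ ↦ 0`, `X_j ↦ 1`, `X_k ↦ X_k`.
DEFINITION (support, data). [cite: CossartPiltant2008, proof of Prop. 4.2] -/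
noncomputable def fibreCoord : Fin (d + 1) → MvPolynomial {k : Fin (d + 1) // k ≠ j} κ :=
  fun k => if k = 0 then 0 else if h : k = j then 1 else X ⟨k, h⟩

/-- The embedding `F = κ[X_k : k ≠ j] → Ω[X₀, …, X_d]`, `X_k ↦ X_k`, coefficients extended to `Ω`.
DEFINITION (support, data). [folklore] -/
noncomputable def fibreEmb : MvPolynomial {k : Fin (d + 1) // k ≠ j} κ →+* MvPolynomial (Fin (d + 1)) Ω :=
  eval₂Hom (C.comp (algebraMap κ Ω)) fun k => X k.1

/-- `fibreEmb` of the fibre face form is the dehomogenisation `δ_j` of the geometric face form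
`Ḡ(0, X₁, …, X_d) ⊗ Ω`. [cite: CossartPiltant2008, proof of Prop. 4.2] -/
theorem fibreEmb_aeval_fibreCoord (hj : j ≠ 0)
    (P : MvPolynomial (Fin (d + 1)) κ) :
    fibreEmb (Ω := Ω) j (aeval (fibreCoord κ j) P) =
      aeval (Function.update X j (1 : MvPolynomial (Fin (d + 1)) Ω))
        (map (algebraMap κ Ω) (FaceFormCutClasses.killZero P)) := by
  change ((fibreEmb (Ω := Ω) j).comp (aeval (fibreCoord κ j)).toRingHom) P =
    ((aeval (Function.update X j (1 : MvPolynomial (Fin (d + 1)) Ω))).toRingHom.comp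
      ((map (algebraMap κ Ω)).comp (FaceFormCutClasses.killZero (K := κ) (d := d)).toRingHom)) P
  congr 1
  refine ringHom_ext (fun a => ?_) (fun k => ?_)
  · simp [fibreEmb, FaceFormCutClasses.killZero]
  · refine Fin.cases ?_ (fun i => ?_) k
    · simp [fibreEmb, fibreCoord, FaceFormCutClasses.killZero]
    · by_cases h : i.succ = j
      · subst h
        simp [fibreEmb, fibreCoord, FaceFormCutClasses.killZero, Fin.succ_ne_zero]
      · simp [fibreEmb, fibreCoord, FaceFormCutClasses.killZero, h, Fin.succ_ne_zero]

/-- The constant coefficient of the Taylor translate `T_v ∘ fibreEmb` is the evaluation `ρ` whenever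
`v_k = ρ(X_k)` (`k ≠ j`) and `ρ` extends `algebraMap κ Ω` on constants. [folklore] -/
theorem constantCoeff_translate_fibreEmb
    (ρ : MvPolynomial {k : Fin (d + 1) // k ≠ j} κ →+* Ω) (hρC : ∀ a, ρ (C a) = algebraMap κ Ω a)
    (v : Fin (d + 1) → Ω) (hv : ∀ (k : Fin (d + 1)) (h : k ≠ j), v k = ρ (X ⟨k, h⟩))
    (g : MvPolynomial {k : Fin (d + 1) // k ≠ j} κ) :
    constantCoeff (aeval (fun i => X i + C (v i)) (fibreEmb (Ω := Ω) j g)) = ρ g := by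
  change (constantCoeff.comp ((aeval (fun i => X i + C (v i) :
      Fin (d + 1) → MvPolynomial (Fin (d + 1)) Ω)).toRingHom.comp (fibreEmb (Ω := Ω) j))) g = ρ g
  congr 1
  refine ringHom_ext (fun a => ?_) (fun k => ?_)
  · simp [fibreEmb, hρC]
  · simp [fibreEmb, hv k.1 k.2]

/-- A polynomial with vanishing constant coefficient lies in the irrelevant ideal `𝔙 = (X₀, …, X_d)`. [folklore] -/
theorem mem_idealOfVars_of_constantCoeff {D : ℕ} (p : MvPolynomial (Fin D) Ω)
    (hp : constantCoeff p = 0) : p ∈ idealOfVars (Fin D) Ω := by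
  have h := mem_pow_idealOfVars_iff (σ := Fin D) (R := Ω) 1 p
  rw [pow_one] at h
  rw [h]
  intro x hx
  rw [Nat.one_le_iff_ne_zero]
  intro h0
  rw [Finsupp.degree_eq_zero_iff] at h0
  subst h0
  exact (mem_support_iff.mp hx) hp

end FibreCoord

section Geom

variable {κ : Type} [Field κ] {Ω : Type} [Field Ω] [Algebra κ Ω] {d : ℕ} (j : Fin (d + 1))

/-- **Order along a fibre prime passes to a good closed point**: `s ∉ 𝔮`, `s·Φ ∈ 𝔮ⁿ`, `M` a finite set of ideals
none `≤ 𝔮` ⇒ a maximal `𝔪 ⊇ 𝔮` outside `M` with `Φ ∈ 𝔪ⁿ`. [cite: Matsumura1987, §5] -/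
theorem exists_isMaximal_mem_pow_of_mul_mem {F : Type} [CommRing F] [IsJacobsonRing F] {𝔮 : Ideal F}
    (h𝔮 : 𝔮.IsPrime) {s Φ : F} (hs : s ∉ 𝔮) {n : ℕ} (h : s * Φ ∈ 𝔮 ^ n) (M : Finset (Ideal F))
    (hM : ∀ 𝔪 ∈ M, ¬ 𝔪 ≤ 𝔮) : ∃ 𝔪 : Ideal F, 𝔪.IsMaximal ∧ 𝔮 ≤ 𝔪 ∧ 𝔪 ∉ M ∧ Φ ∈ 𝔪 ^ n := by
  obtain ⟨𝔪, h𝔪, hq, hsm, hmM⟩ := exists_isMaximal_avoid h𝔮 hs M hM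
  exact ⟨𝔪, h𝔪, hq, hmM, mem_pow_of_mul_mem_pow h𝔪 hsm n (Ideal.pow_right_mono hq n h)⟩

/-- **The generic-point contradiction.**  See the module docstring.
[cite: CossartPiltant2008, proof of Prop. 4.2] [cite: Hironaka1964, Ch. III §3] -/
theorem false_of_generic [IsAlgClosed Ω] (hj : j ≠ 0) {n : ℕ} (P : MvPolynomial (Fin (d + 1)) κ)
    (hP : P.IsHomogeneous (n + 1)) (𝔮 : Ideal (MvPolynomial {k : Fin (d + 1) // k ≠ j} κ)) (h𝔮 : 𝔮.IsPrime)
    (hX0 : (X ⟨0, Ne.symm hj⟩ : MvPolynomial {k : Fin (d + 1) // k ≠ j} κ) ∈ 𝔮)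
    {s : MvPolynomial {k : Fin (d + 1) // k ≠ j} κ} (hs : s ∉ 𝔮) (hΦ : s * aeval (fibreCoord κ j) P ∈ 𝔮 ^ n)
    {m : ℕ} (wb : Fin m → Fin (d + 1) → κ)
    (hM : ∀ i, wb i j ≠ 0 → ∃ k : {k : Fin (d + 1) // k ≠ j},
      X k * C (wb i j) - C (wb i k.1) ∉ 𝔮)
    (hgen : ∀ v : Fin (d + 1) → Ω, v ≠ 0 → v 0 = 0 →
      FaceFormCutClasses.MultLT (map (algebraMap κ Ω) (FaceFormCutClasses.killZero P)) v n ∨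
        ∃ i, ∃ a : Ω, a ≠ 0 ∧ ∀ k, algebraMap κ Ω (wb i k) = a * v k) :
    False := by
  classical
  have hj0 : (0 : Fin (d + 1)) ≠ j := Ne.symm hj
  -- the listed rational points of the chart, as maximal ideals `ker ev_{ω_i}`
  let ω : Fin m → {k : Fin (d + 1) // k ≠ j} → κ := fun i k => wb i k.1 / wb i j
  let M : Finset (Ideal (MvPolynomial {k : Fin (d + 1) // k ≠ j} κ)) :=
    (Finset.univ.filter fun i => wb i j ≠ 0).image fun i => RingHom.ker (aeval (R := κ) (ω i))
  have hMq : ∀ 𝔪 ∈ M, ¬ 𝔪 ≤ 𝔮 := by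
    intro 𝔪 h𝔪 hle
    obtain ⟨i, hi, rfl⟩ := Finset.mem_image.mp h𝔪
    have hij : wb i j ≠ 0 := (Finset.mem_filter.mp hi).2
    obtain ⟨k, hk⟩ := hM i hij
    refine hk (hle ?_)
    rw [RingHom.mem_ker]
    simp [ω, div_mul_cancel₀ _ hij]
  -- a good closed point
  obtain ⟨𝔫, h𝔫, hq𝔫, h𝔫M, hΦ𝔫⟩ := exists_isMaximal_mem_pow_of_mul_mem h𝔮 hs hΦ M hMq
  -- its geometric point `ρ : F → F/𝔫 → Ω`
  haveI := h𝔫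
  letI := Ideal.Quotient.field 𝔫
  haveI : Algebra.IsIntegral κ (MvPolynomial {k : Fin (d + 1) // k ≠ j} κ ⧸ 𝔫) :=
    ⟨fun x => (MvPolynomial.comp_C_integral_of_surjective_of_isJacobsonRing _
      Ideal.Quotient.mk_surjective) x⟩
  let ev : (MvPolynomial {k : Fin (d + 1) // k ≠ j} κ ⧸ 𝔫) →ₐ[κ] Ω := IsAlgClosed.lift
  let ρ : MvPolynomial {k : Fin (d + 1) // k ≠ j} κ →+* Ω := ev.toRingHom.comp (Ideal.Quotient.mk 𝔫)
  have hρ0 : ∀ g, ρ g = 0 ↔ g ∈ 𝔫 := fun g => by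
    simp only [ρ, RingHom.comp_apply, map_eq_zero_iff _ ev.toRingHom.injective,
      Ideal.Quotient.eq_zero_iff_mem]
  have hρC : ∀ a, ρ (C a) = algebraMap κ Ω a := fun a => by
    change ev (Ideal.Quotient.mk 𝔫 (C a)) = _
    exact ev.commutes a
  -- the direction `v` of the closed point
  let v : Fin (d + 1) → Ω := fun k => if h : k = j then 1 else ρ (X ⟨k, h⟩)
  have hvj : v j = 1 := by simp [v]
  have hvk : ∀ (k : Fin (d + 1)) (h : k ≠ j), v k = ρ (X ⟨k, h⟩) := fun k h => by simp [v, h]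
  have hv0 : v 0 = 0 := by
    rw [hvk 0 hj0]
    exact (hρ0 _).mpr (hq𝔫 hX0)
  have hvne : v ≠ 0 := fun h => by
    have h1 := congr_fun h j
    rw [hvj, Pi.zero_apply] at h1
    exact one_ne_zero h1
  -- transfer: `T_v (δ_j geomFace) ∈ 𝔙ⁿ`
  have hvars : Ideal.map ((aeval (fun i => X i + C (v i) :
      Fin (d + 1) → MvPolynomial (Fin (d + 1)) Ω)).toRingHom.comp (fibreEmb (Ω := Ω) j)) 𝔫 ≤
      idealOfVars (Fin (d + 1)) Ω := by
    rw [Ideal.map_le_iff_le_comap]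
    intro g hg
    rw [Ideal.mem_comap]
    refine mem_idealOfVars_of_constantCoeff _ ?_
    change constantCoeff (aeval (fun i => X i + C (v i)) (fibreEmb (Ω := Ω) j g)) = 0
    rw [constantCoeff_translate_fibreEmb j ρ hρC v hvk g]
    exact (hρ0 g).mpr hg
  have hpow : aeval (fun i => X i + C (v i)) (fibreEmb (Ω := Ω) j (aeval (fibreCoord κ j) P)) ∈
      idealOfVars (Fin (d + 1)) Ω ^ n := by
    have h1 := Ideal.mem_map_of_mem ((aeval (fun i => X i + C (v i) :
      Fin (d + 1) → MvPolynomial (Fin (d + 1)) Ω)).toRingHom.comp (fibreEmb (Ω := Ω) j)) hΦ𝔫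
    rw [Ideal.map_pow] at h1
    exact Ideal.pow_right_mono hvars n h1
  rw [fibreEmb_aeval_fibreCoord j hj] at hpow
  have hPh : (map (algebraMap κ Ω) (FaceFormCutClasses.killZero P)).IsHomogeneous (n + 1) := by
    have h := hP.aeval (Fin.cases (0 : MvPolynomial (Fin (d + 1)) κ) fun i => X i.succ)
      (n := 1) (Fin.cases (isHomogeneous_zero _ _ _) fun i => isHomogeneous_X _ _)
    simpa [FaceFormCutClasses.killZero] using h.map (algebraMap κ Ω)
  have hnot := not_multLT_of_mem_pow j hPh v hvj hpow
  rcases hgen v hvne hv0 with hlt | ⟨i, a, ha, hmatch⟩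
  · exact hnot hlt
  -- the matched direction is a listed rational point, and it is `𝔫`
  have hij : wb i j ≠ 0 := by
    intro h
    have h1 := hmatch j
    rw [h, map_zero, hvj, mul_one] at h1
    exact ha h1.symm
  have ha' : a = algebraMap κ Ω (wb i j) := by
    have h1 := hmatch j
    rw [hvj, mul_one] at h1
    exact h1.symm
  have hsurj : Function.Surjective (aeval (R := κ) (ω i)) := fun b => ⟨C b, by simp⟩
  have hρω : ρ = (algebraMap κ Ω).comp (aeval (R := κ) (ω i)).toRingHom := by
    refine ringHom_ext (fun b => ?_) (fun k => ?_)
    · simp [hρC]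
    · have h1 := hmatch k.1
      rw [hvk k.1 k.2, ha'] at h1
      have hne : algebraMap κ Ω (wb i j) ≠ 0 := by rwa [← ha']
      simp only [RingHom.comp_apply, AlgHom.toRingHom_eq_coe, RingHom.coe_coe, aeval_X, ω, map_div₀]
      rw [eq_div_iff hne, mul_comm]
      exact h1.symm
  have hle : RingHom.ker (aeval (R := κ) (ω i)) ≤ 𝔫 := by
    intro g hg
    rw [← hρ0 g, hρω, RingHom.comp_apply, AlgHom.toRingHom_eq_coe, RingHom.coe_coe,
      (RingHom.mem_ker).mp hg, map_zero]
  have heq : RingHom.ker (aeval (R := κ) (ω i)) = 𝔫 :=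
    (RingHom.ker_isMaximal_of_surjective _ hsurj).eq_of_le h𝔫.ne_top hle
  exact h𝔫M (Finset.mem_image.mpr ⟨i, Finset.mem_filter.mpr ⟨Finset.mem_univ _, hij⟩, heq⟩)

end Geom

end Summit.ResolutionOfSingularities.ResolutionOfSingularities.Theorems.NearExit
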